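import Summits.BirchSwinnertonDyer.Uniform.U2.GenusPointRingClassTwo
import Literature.NumberTheory.EllipticCurves.HeegnerPointsOfConductorRationalityProofs
import HarnessLib

/-!
# Cell «bsd-uniform», track U2, route C — Theorem A′ (first half) for EVERY square-free conductor
# supported on inert `a_q`-odd primes: the COMPOSED TRACE `Tr_{K[n]/K} y_n = (∏_{q ∣ n} a_q) · y_K`
# as a KERNEL THEOREM (residue R2-11 beyond one or two inert primes CLOSED for the inert family)

HONEST FRAMING (cell «bsd-uniform», run/shared/lean/pub/bsd-uniform/, seat u2-p1): a THEOREM under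
named binders, no claim about BSD beyond it; nothing booked, no census number moved, no per-curve
certificate counted as uniform. Until now route C's composed trace relation
`htr : Σ_{σ ∈ Gal(K[|d|]/K)} σ·y = m·y_K` (`m` odd) — the hypothesis of the end-to-end heads
`bsdp_two_of_genusTheory_*` — was a kernel theorem only for `|d|` ONE inert `a_q`-odd prime
(`genusPoint_not_isOfFinAddOrder_inert`, u2-p3) or a product of TWO
(`genusPoint_not_isOfFinAddOrder_inert_two`), and a BINDER otherwise (HOME/RESIDUE.md R2-11). This
file proves it for EVERY square-free `n` prime to `N` all of whose prime factors are inert in `K`,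
by strong induction on `n` along the ring class tower `K ⊂ K[1] ⊂ K[M] ⊂ K[Mq] = K[n]`:

* the one-step relation is the landed printed fact `CoatesLiTianZhai2015.traceRelation_inert`
  (CLTZ 2015 Lemma 2.9, "general fact first observed by Kolyvagin": `Tr_{K[Mq]/K[M]} y_{Mq} = a_q·y_M`
  for `q ∤ MN` inert), used once per prime factor;
* the Heegner points `y_M ∈ E(K[M])` at the INTERMEDIATE conductors are no longer data: they come from
  the tree THEOREM `phi_heegnerPointOfConductor_mem_range_map_ringClassField_holds` (Gross 1991 §3,
  Darmon 2004 Thm. 3.6: `x(M)` is rational over `K[M]`; PROVED in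
  `HeegnerPointsOfConductorRationalityProofs.lean`), and `K[M]` is a number field
  (`numberField_ringClassField`, from `finiteDimensional_and_isGalois_ringClassField`);
* the transport of the lower levels into `Gal(K[n]/K)` is u2-p3's
  `RingClassRestrictionTrace.sum_quotient_pointGalHom_eq_smul_of_step`, the fold inside
  `Gal(K[n]/K[1])` is `sum_subgroup_eq_mul_smul_of_step` (a two-line corollary of
  `GenusCongruence.sum_eq_smul_sum_quotient_of_trace_eq_smul`), and the multiplier bookkeeping is
  `(Mq).primeFactors = M.primeFactors ∪ {q}`.

So the multiplier is `m = ∏_{q ∣ n} a_q` (odd iff every `a_q` is odd — the cell's class condition), as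
printed (Bradshaw–Stein 2012 §3 «`Tr_{K_c/K} y_c = a_c y_K`»; CLTZ 2015 (h9)). What REMAINS a binder
of route C after this file: `htr` for `d` with a SPLIT prime factor (Darmon 2004 Prop. 3.10, multiplier
`a_q − σ − σ⁻¹`; the one-step fold `GenusCongruence.sum_eq_sub_two_smul_sum_quotient_of_trace_eq`
exists, the printed fact in `pointGalHom` currency does not), L1 `h2L`, (H-y), Gross's (4.1) reading
`hyK` of `y_K` and the datum `y₁ ∈ E(K[1])`; and CLTZ's standing field `K = ℚ(√−ℓ₀)` (`ℓ₀ > 3` prime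
`≡ 3 (mod 4)`), verbatim the binder of the landed fact.

Design note: the main theorem takes the `Fintype` structure of `Gal(K[n]/K[1])` as an IMPLICIT
argument `{instF}` (unified from the caller's `[NumberField (ringClassField K ι n)]`), not a
`[NumberField …]` instance binder: with the synthesized instance inside the induction motive the kernel
does not terminate (measured: deterministic kernel timeout on the bare `induction` skeleton), with the
implicit structure it checks in seconds. The consumers (`sum_ringClassGal_eq_prod_smul_of_inert`,
`genusPoint_not_isOfFinAddOrder_inert_squarefree`) keep the usual `[NumberField (ringClassField K ι n)]`.

## Contents
* `sum_subgroup_eq_mul_smul_of_step` — pure bookkeeping: one more level of a tower inside `H₁ ≤ G`.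
* `numberField_ringClassField` — `K[n]` is a number field (`n ≠ 0`).
* `eq_one_of_mem_ringClassGalOver_self`, `sum_ringClassGalOver_self`, `sum_ringClassGalOver_one_one_eq`
  — `Gal(K[n]/K[n]) = 1` and the base of the induction.
* `sum_ringClassGalOver_one_eq_prod_smul_of_inert` — **the composed relation over `Gal(K[n]/K[1])`**:
  `Σ_{τ ∈ Gal(K[n]/K[1])} τ·y = (∏_{q ∣ n} a_q) · incl_{1→n}(y₁)` in `E(K[n])`.
* `sum_ringClassGal_eq_prod_smul_of_inert` — with Gross's (4.1) `Tr_{K[1]/K} y₁ = y_K` (binder `hyK`):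
  `Σ_{σ ∈ Gal(K[n]/K)} σ·y = (∏_{q ∣ n} a_q) · y_K` — literally the heads' `htr` with `m₀ = ∏ a_q`.
* `genusPoint_not_isOfFinAddOrder_inert_squarefree` — Theorem A′ (first half): for all `a_q` odd,
  L1 and (H-y), every signed sum `Σ_σ s(σ)·σy` has infinite order in `E(K[n])`.

References: Coates–Li–Tian–Zhai 2015 Lemma 2.9 [CoatesLiTianZhai2015]; Gross 1991 §3–§4, (4.1)
[GrossLMS1991]; Darmon 2004 Thm. 3.6, Prop. 3.10 [Darmon2004]; Bradshaw–Stein, J. Number Theory 132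
(2012) §3; T4-PROOF.md v1.9b §3 L2′, §4 Thm A (HOME).
-/

noncomputable section

open scoped Classical

open WeierstrassCurve NumberField Literature.NumberTheory.EllipticCurves
  Literature.NumberTheory.EllipticCurves.ModularForms

set_option autoImplicit false

namespace Summit.BirchSwinnertonDyer.Uniform.U2.RingClass

/-! ## §1 Pure bookkeeping: one more level of the tower inside a subgroup `H₁` -/

/-- **Tower step inside `H₁`** (`H_M ≤ H₁ ≤ G`, e.g. `Gal(K[n]/K[M]) ≤ Gal(K[n]/K[1]) ≤ Gal(K[n]/K)`):
`Σ_{k ∈ H_M} ρ k y = a·z` and `Σ_{e ∈ H₁/H_M} ρ ẽ z = b·w` give `Σ_{g ∈ H₁} ρ g y = (a·b)·w`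
(`GenusCongruence.sum_eq_smul_sum_quotient_of_trace_eq_smul` for the group `H₁`). [folklore] -/
theorem sum_subgroup_eq_mul_smul_of_step {A : Type*} [AddCommGroup A] {G : Type*} [Group G]
    (ρ : G →* AddMonoid.End A) {H₁ HM : Subgroup G} [Fintype H₁] [Fintype (HM.subgroupOf H₁)]
    [Fintype (H₁ ⧸ HM.subgroupOf H₁)] {y z w : A} {a b : ℤ}
    (htop : ∑ k : HM.subgroupOf H₁, ρ ((k : H₁) : G) y = a • z)
    (hmid : ∑ e : H₁ ⧸ HM.subgroupOf H₁, ρ ((e.out : H₁) : G) z = b • w) :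
    ∑ g : H₁, ρ (g : G) y = (a * b) • w := by
  have h := GenusCongruence.sum_eq_smul_sum_quotient_of_trace_eq_smul (ρ.comp H₁.subtype)
    (HM.subgroupOf H₁) (P := y) (P₁ := z) (a := a)
    (by simpa only [MonoidHom.comp_apply, Subgroup.coe_subtype] using htop)
  simp only [MonoidHom.comp_apply, Subgroup.coe_subtype] at h
  rw [h, hmid, smul_smul]

variable {K : Type} [Field K] [NumberField K] (ι : K →+* ℂ)

/-! ## §2 The tower of ring class fields: instances and the trivial top step -/

/-- `K[n]` (`n ≠ 0`, `K` imaginary quadratic) is a number field: it is finite over `K`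
(`finiteDimensional_and_isGalois_ringClassField`). Supplies the `[NumberField (ringClassField K ι M)]`
instances of the intermediate levels of the tower. [folklore] -/
theorem numberField_ringClassField (hK : IsImaginaryQuadratic K) (n : ℕ) (hn : n ≠ 0) :
    NumberField (ringClassField K ι n) := by
  haveI := (finiteDimensional_and_isGalois_ringClassField hK ι hn).1
  exact NumberField.of_module_finite K _

/-- `Gal(K[n]/K[n])` is trivial: its only element is the identity. [folklore] -/
theorem eq_one_of_mem_ringClassGalOver_self {n : ℕ} (τ : ringClassGalOver ι n n) : τ = 1 :=
  Subtype.ext (AlgEquiv.ext fun x => (mem_ringClassGalOver_iff ι τ.1).mp τ.2 x x.2)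

/-- The trace over the trivial group `Gal(K[n]/K[n])` is the identity. [folklore] -/
theorem sum_ringClassGalOver_self (W : WeierstrassCurve ℚ) {n : ℕ} {_ : Fintype (ringClassGalOver ι n n)}
    (P : (W.baseChange (ringClassField K ι n : Type)).toAffine.Point) :
    ∑ τ : ringClassGalOver ι n n, pointGalHom W (ringClassField K ι n) τ.1 P = P := by
  have huniv : (Finset.univ : Finset (ringClassGalOver ι n n)) = {1} := by
    ext τ
    simp only [Finset.mem_univ, Finset.mem_singleton, true_iff]
    exact eq_one_of_mem_ringClassGalOver_self ι τ
  rw [huniv, Finset.sum_singleton, OneMemClass.coe_one, map_one]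
  rfl

/-- Level one: a point of `E(K[1])` with the complex coordinates of `x(1)` is `incl_{1→1}(y₁)`, and its
trace over the trivial group `Gal(K[1]/K[1])` is itself (base of the induction). [folklore] -/
theorem sum_ringClassGalOver_one_one_eq (W : WeierstrassCurve ℚ) [W.IsElliptic] [W.IsGloballyMinimal]
    (hK : IsImaginaryQuadratic K)
    {_ : Fintype (ringClassGalOver ι 1 1)}
    {P₁ : (W.baseChange ℂ).toAffine.Point}
    (y₁ : (W.baseChange (ringClassField K ι 1 : Type)).toAffine.Point)
    (hy₁ : WeierstrassCurve.Affine.Point.map (ringClassField K ι 1).subtype.toRatAlgHom y₁ = P₁)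
    (y : (W.baseChange (ringClassField K ι 1 : Type)).toAffine.Point)
    (hy : WeierstrassCurve.Affine.Point.map (ringClassField K ι 1).subtype.toRatAlgHom y = P₁)
    (h11 : (1 : ℕ) ∣ 1) (h10 : (1 : ℕ) ≠ 0) :
    ∑ τ : ringClassGalOver ι 1 1, pointGalHom W (ringClassField K ι 1) τ.1 y =
      (∏ p ∈ (1 : ℕ).primeFactors, W.frobeniusTrace p) •
        WeierstrassCurve.Affine.Point.map (W' := W)
          (RingClassField.inclusion ι (ringClassField_mono hK ι h11 h10)).toRingHom.toRatAlgHom y₁ := by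
  rw [sum_ringClassGalOver_self ι W y, Nat.primeFactors_one, Finset.prod_empty, one_smul]
  apply WeierstrassCurve.Affine.Point.map_injective (W' := W)
    (f := (ringClassField K ι 1).subtype.toRatAlgHom)
  rw [hy, map_subtype_map_inclusion ι hK h11 h10 W y₁, hy₁]

/-! ## §3 The composed inert trace relation, by induction over the tower -/

/-- **THE COMPOSED INERT TRACE RELATION over `Gal(K[n]/K[1])`, any square-free conductor.** Standing
binders verbatim those of `CoatesLiTianZhai2015.traceRelation_inert`: `E/ℚ` globally minimal of
conductor `N`, `K = ℚ(√−ℓ₀)` (`ℓ₀ > 3` prime, `ℓ₀ ≡ 3 (mod 4)`, `d_K = −ℓ₀`), Heegner hypothesis for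
`N`, `ι`, a parametrisation datum `Dt`, an orientation `β`; data `y₁ ∈ E(K[1])` over `x(1)`. Then for
every square-free `n ≠ 0` prime to `N` whose prime factors `q` are all INERT in `K`, and every
`y ∈ E(K[n])` over `x(n)`:
`Σ_{τ ∈ Gal(K[n]/K[1])} τ·y = (∏_{q ∣ n} a_q) · incl_{K[1]→K[n]}(y₁)` in `E(K[n])`.
Proof: strong induction on `n`; `n = 1` is `Gal(K[1]/K[1]) = 1`; for `n = Mq` the printed step
`Tr_{K[Mq]/K[M]} y = a_q · y_M` (CLTZ Lemma 2.9, with `y_M ∈ E(K[M])` from the PROVED rationality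
`phi_heegnerPointOfConductor_mem_range_map_ringClassField_holds`), the induction hypothesis at `M`
transported into `Gal(K[Mq]/K)` (`sum_quotient_pointGalHom_eq_smul_of_step`) and the coset fold
(`sum_subgroup_eq_mul_smul_of_step`).
[cite: CoatesLiTianZhai2015, Lemma 2.9 (general fact)] [cite: GrossLMS1991, §3 (x_n rational over K_n)] -/
theorem sum_ringClassGalOver_one_eq_prod_smul_of_inert
    (hCLTZ : CoatesLiTianZhai2015.traceRelation_inert)
    (W : WeierstrassCurve ℚ) [W.IsElliptic] [W.IsGloballyMinimal] [NeZero (W.conductorNorm ℤ)]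
    (hK : IsImaginaryQuadratic K)
    (ℓ₀ : ℕ) (hℓ₀ : ℓ₀.Prime) (hℓ₀' : 3 < ℓ₀) (hℓ₀'' : ℓ₀ % 4 = 3)
    (hKℓ₀ : NumberField.discr K = -(ℓ₀ : ℤ))
    (hH : SatisfiesHeegnerHypothesis (W.conductorNorm ℤ) K)
    (Dt : ModularParametrizationData W (W.conductorNorm ℤ)) (β : ℤ)
    (hβ : (4 * (W.conductorNorm ℤ : ℤ)) ∣ β ^ 2 - NumberField.discr K)
    (y₁ : (W.baseChange (ringClassField K ι 1 : Type)).toAffine.Point)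
    (hy₁ : WeierstrassCurve.Affine.Point.map (ringClassField K ι 1).subtype.toRatAlgHom y₁ =
      heegnerPointComplexOfConductor Dt (NumberField.discr K) β 1)
    (n : ℕ) {instF : Fintype (ringClassGalOver ι n 1)} (hn : n ≠ 0) (hsq : Squarefree n)
    (hnC : Nat.Coprime n (W.conductorNorm ℤ))
    (hinert : ∀ p : ℕ, p.Prime → p ∣ n → (Ideal.span {(p : 𝓞 K)}).IsPrime)
    (y : (W.baseChange (ringClassField K ι n : Type)).toAffine.Point)
    (hy : WeierstrassCurve.Affine.Point.map (ringClassField K ι n).subtype.toRatAlgHom y =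
      heegnerPointComplexOfConductor Dt (NumberField.discr K) β n) :
    ∑ τ : ringClassGalOver ι n 1, pointGalHom W (ringClassField K ι n) τ.1 y =
      (∏ p ∈ n.primeFactors, W.frobeniusTrace p) •
        WeierstrassCurve.Affine.Point.map (W' := W)
          (RingClassField.inclusion ι (ringClassField_mono hK ι (one_dvd n) hn)).toRingHom.toRatAlgHom y₁ := by
  induction n using Nat.strong_induction_on with
  | _ n ih =>
  by_cases h1 : n = 1
  · -- BASE `n = 1`: `Gal(K[1]/K[1])` is trivial and `y = incl y₁` (same complex coordinates)
    subst h1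
    exact sum_ringClassGalOver_one_one_eq ι W hK y₁ hy₁ y hy (one_dvd 1) hn
  · -- STEP `n = M * p`
    obtain ⟨p, hp, hpn⟩ := Nat.exists_prime_and_dvd h1
    obtain ⟨M, hM⟩ : ∃ M, n = M * p := ⟨n / p, (Nat.div_mul_cancel hpn).symm⟩
    subst hM
    have hM0 : M ≠ 0 := fun h => hn (by rw [h, zero_mul])
    have hcop : Nat.Coprime M p := (Nat.squarefree_mul_iff.mp hsq).1
    have hsqM : Squarefree M := (Nat.squarefree_mul_iff.mp hsq).2.1
    have hMC : Nat.Coprime M (W.conductorNorm ℤ) := Nat.Coprime.coprime_mul_right hnC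
    have hpC : Nat.Coprime p (W.conductorNorm ℤ) := Nat.Coprime.coprime_mul_left hnC
    have hpMC : Nat.Coprime p (M * W.conductorNorm ℤ) := Nat.Coprime.mul_right hcop.symm hpC
    have hMlt : M < M * p := lt_mul_of_one_lt_right (Nat.pos_of_ne_zero hM0) hp.one_lt
    have hMn : M ∣ M * p := Dvd.intro p rfl
    haveI hNF : NumberField (ringClassField K ι (M * p)) := numberField_ringClassField ι hK _ hn
    haveI hNFM : NumberField (ringClassField K ι M) := numberField_ringClassField ι hK M hM0
    -- the Heegner point of conductor `M` is `K[M]`-rational (tree theorem)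
    obtain ⟨z, hz⟩ := phi_heegnerPointOfConductor_mem_range_map_ringClassField_holds
      (W.conductorNorm ℤ) W K hK hH Dt β ι M hβ hM0 hMC
    -- induction hypothesis at level `M`, for `z`
    have hIH := ih M hMlt (instF := inferInstance) hM0 hsqM hMC
      (fun q hq hqM => hinert q hq (hqM.trans hMn)) z hz
    -- TOP STEP `K[Mp]/K[M]`: the printed fact, pulled back to `E(K[Mp])`
    have hzL : WeierstrassCurve.Affine.Point.map (ringClassField K ι (M * p)).subtype.toRatAlgHom
        (WeierstrassCurve.Affine.Point.map (W' := W)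
          (RingClassField.inclusion ι (ringClassField_mono hK ι hMn hn)).toRingHom.toRatAlgHom z) =
        heegnerPointComplexOfConductor Dt (NumberField.discr K) β M := by
      rw [map_subtype_map_inclusion ι hK hMn hn W z, hz]
    have hrelC := hCLTZ W K hK ℓ₀ hℓ₀ hℓ₀' hℓ₀'' hKℓ₀ hH ι Dt β hβ M hM0 hMC p hp hpMC
      (hinert p hp (Dvd.intro_left M rfl)) y hy
    rw [← hzL] at hrelC
    have htop := sum_pointGalHom_eq_smul_of_finsum ι (M * p) W M y _ _ hrelC
    -- the induction hypothesis transported into `Gal(K[Mp]/K)`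
    have hmid := sum_quotient_pointGalHom_eq_smul_of_step ι hK hMn hn (one_dvd M) W z y₁
      (∏ q ∈ M.primeFactors, W.frobeniusTrace q) hIH
    -- `H_M ≤ H₁ ≤ G = Gal(K[Mp]/K)`; the top step re-indexed over `H_M.subgroupOf H₁`
    have hle₁ : ringClassGalOver ι (M * p) 1 ≤ ringClassGal ι (M * p) :=
      ringClassGalOver_le_ringClassGal ι (M * p) 1
    have hleM : ringClassGalOver ι (M * p) M ≤ ringClassGal ι (M * p) :=
      ringClassGalOver_le_ringClassGal ι (M * p) M
    have hle : (ringClassGalOver ι (M * p) M).subgroupOf (ringClassGal ι (M * p)) ≤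
        (ringClassGalOver ι (M * p) 1).subgroupOf (ringClassGal ι (M * p)) :=
      fun σ hσ => Subgroup.mem_subgroupOf.mpr
        (ringClassGalOver_anti ι hK hMn hn (one_dvd M) (Subgroup.mem_subgroupOf.mp hσ))
    have htop' : ∑ k : ((ringClassGalOver ι (M * p) M).subgroupOf (ringClassGal ι (M * p))).subgroupOf
        ((ringClassGalOver ι (M * p) 1).subgroupOf (ringClassGal ι (M * p))),
        ((pointGalHom W (ringClassField K ι (M * p))).comp (ringClassGal ι (M * p)).subtype)
          ((k : (ringClassGalOver ι (M * p) 1).subgroupOf (ringClassGal ι (M * p))) :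
            ringClassGal ι (M * p)) y =
        (W.frobeniusTrace p) • WeierstrassCurve.Affine.Point.map (W' := W)
          (RingClassField.inclusion ι (ringClassField_mono hK ι hMn hn)).toRingHom.toRatAlgHom z := by
      rw [← htop]
      exact Fintype.sum_equiv
        ((Subgroup.subgroupOfEquivOfLe hle).toEquiv.trans (Subgroup.subgroupOfEquivOfLe hleM).toEquiv)
        _ _ (fun _ => rfl)
    -- fold inside `H₁`, then back to `Gal(K[Mp]/K[1])` and the multiplier bookkeeping
    have hfold := sum_subgroup_eq_mul_smul_of_step
      ((pointGalHom W (ringClassField K ι (M * p))).comp (ringClassGal ι (M * p)).subtype) htop' hmid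
    have hsum : ∑ τ : ringClassGalOver ι (M * p) 1, pointGalHom W (ringClassField K ι (M * p)) τ.1 y =
        ∑ g : (ringClassGalOver ι (M * p) 1).subgroupOf (ringClassGal ι (M * p)),
          ((pointGalHom W (ringClassField K ι (M * p))).comp (ringClassGal ι (M * p)).subtype)
            (g : ringClassGal ι (M * p)) y :=
      (Fintype.sum_equiv (Subgroup.subgroupOfEquivOfLe hle₁).toEquiv _ _ (fun _ => rfl)).symm
    rw [hsum, hfold, Nat.Coprime.primeFactors_mul hcop, hp.primeFactors,
      Finset.prod_union (Finset.disjoint_singleton_right.mpr (fun h => hp.ne_one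
        ((Nat.coprime_comm.mp hcop).eq_one_of_dvd (Nat.dvd_of_mem_primeFactors h)))),
      Finset.prod_singleton, mul_comm (W.frobeniusTrace p)]

/-! ## §4 Down to `K`: the heads' `htr`, and Theorem A′ (first half) for the inert family -/

/-- **THE COMPOSED INERT TRACE RELATION over `Gal(K[n]/K)` — literally the end-to-end heads' binder
`htr` with `m₀ = ∏_{q ∣ n} a_q`.** Under the binders of
`sum_ringClassGalOver_one_eq_prod_smul_of_inert` and Gross's (4.1) `Tr_{K[1]/K} y₁ = y_K` read in
`E(K[n])` (binder `hyK`, the datum `y_K ∈ E(K)`):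
`Σ_{σ ∈ Gal(K[n]/K)} σ·y = (∏_{q ∣ n} a_q) · y_K` in `E(K[n])` (coset fold
`GenusCongruence.sum_eq_smul_sum_quotient_of_trace_eq_smul` over `Gal(K[n]/K[1]) ≤ Gal(K[n]/K)`).
[cite: CoatesLiTianZhai2015, Lemma 2.9 (general fact)] [cite: GrossLMS1991, §4 (4.1)] -/
theorem sum_ringClassGal_eq_prod_smul_of_inert
    (hCLTZ : CoatesLiTianZhai2015.traceRelation_inert)
    (W : WeierstrassCurve ℚ) [W.IsElliptic] [W.IsGloballyMinimal] [NeZero (W.conductorNorm ℤ)]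
    (hK : IsImaginaryQuadratic K)
    (ℓ₀ : ℕ) (hℓ₀ : ℓ₀.Prime) (hℓ₀' : 3 < ℓ₀) (hℓ₀'' : ℓ₀ % 4 = 3)
    (hKℓ₀ : NumberField.discr K = -(ℓ₀ : ℤ))
    (hH : SatisfiesHeegnerHypothesis (W.conductorNorm ℤ) K)
    (Dt : ModularParametrizationData W (W.conductorNorm ℤ)) (β : ℤ)
    (hβ : (4 * (W.conductorNorm ℤ : ℤ)) ∣ β ^ 2 - NumberField.discr K)
    (y₁ : (W.baseChange (ringClassField K ι 1 : Type)).toAffine.Point)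
    (hy₁ : WeierstrassCurve.Affine.Point.map (ringClassField K ι 1).subtype.toRatAlgHom y₁ =
      heegnerPointComplexOfConductor Dt (NumberField.discr K) β 1)
    (n : ℕ) [NumberField (ringClassField K ι n)] (hn : n ≠ 0) (hsq : Squarefree n)
    (hnC : Nat.Coprime n (W.conductorNorm ℤ))
    (hinert : ∀ p : ℕ, p.Prime → p ∣ n → (Ideal.span {(p : 𝓞 K)}).IsPrime)
    (y : (W.baseChange (ringClassField K ι n : Type)).toAffine.Point)
    (hy : WeierstrassCurve.Affine.Point.map (ringClassField K ι n).subtype.toRatAlgHom y =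
      heegnerPointComplexOfConductor Dt (NumberField.discr K) β n)
    (yK : (W.baseChange K).toAffine.Point)
    (hyK : ∑ c : ringClassGal ι n ⧸ (ringClassGalOver ι n 1).subgroupOf (ringClassGal ι n),
        pointGalHom W (ringClassField K ι n) (c.out : ringClassGal ι n).1
          (WeierstrassCurve.Affine.Point.map (W' := W)
            (RingClassField.inclusion ι
              (ringClassField_mono hK ι (one_dvd n) hn)).toRingHom.toRatAlgHom y₁) =
      WeierstrassCurve.Affine.Point.map (W' := W)
        (algebraMap K (ringClassField K ι n)).toRatAlgHom yK) :
    ∑ σ : ringClassGal ι n, pointGalHom W (ringClassField K ι n) σ.1 y =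
      (∏ p ∈ n.primeFactors, W.frobeniusTrace p) •
        WeierstrassCurve.Affine.Point.map (W' := W)
          (algebraMap K (ringClassField K ι n)).toRatAlgHom yK := by
  have hle : ringClassGalOver ι n 1 ≤ ringClassGal ι n := ringClassGalOver_le_ringClassGal ι n 1
  have hmain := sum_ringClassGalOver_one_eq_prod_smul_of_inert ι hCLTZ W hK ℓ₀ hℓ₀ hℓ₀' hℓ₀'' hKℓ₀ hH
    Dt β hβ y₁ hy₁ n (instF := inferInstance) hn hsq hnC hinert y hy
  have hrelH : ∑ h : (ringClassGalOver ι n 1).subgroupOf (ringClassGal ι n),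
      ((pointGalHom W (ringClassField K ι n)).comp (ringClassGal ι n).subtype)
        (h : ringClassGal ι n) y =
      (∏ p ∈ n.primeFactors, W.frobeniusTrace p) •
        WeierstrassCurve.Affine.Point.map (W' := W)
          (RingClassField.inclusion ι
            (ringClassField_mono hK ι (one_dvd n) hn)).toRingHom.toRatAlgHom y₁ := by
    rw [← hmain]
    exact Fintype.sum_equiv (Subgroup.subgroupOfEquivOfLe hle).toEquiv _ _ (fun _ => rfl)
  have htrρ := GenusCongruence.sum_eq_smul_sum_quotient_of_trace_eq_smul
    ((pointGalHom W (ringClassField K ι n)).comp (ringClassGal ι n).subtype) _ hrelH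
  simp only [MonoidHom.comp_apply, Subgroup.coe_subtype] at htrρ
  rw [hyK] at htrρ
  exact htrρ

/-- **Theorem A′, first half, for EVERY square-free conductor supported on inert `a_q`-odd primes.**
Under the binders of `sum_ringClassGal_eq_prod_smul_of_inert`, with every `a_q` (`q ∣ n`) ODD, L1
`E(K[n])[2] = 0` (`h2L`) and (H-y) `y_K ∉ 2E(K)` (`hHy`): for every sign function `s` on
`Gal(K[n]/K)` — in particular the genus character `χ_d` — the point `Σ_σ s(σ)·σy` has infinite order
in `E(K[n])` (`genusPoint_not_isOfFinAddOrder_of_trace` with `m = ∏ a_q`, odd). Supersedes the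
one-prime and two-prime theorems `genusPoint_not_isOfFinAddOrder_inert{,_two}` (u2-p3).
[cite: CoatesLiTianZhai2015, Lemma 2.9 (general fact)] [cite: GrossLMS1991, §4 (4.1)] -/
theorem genusPoint_not_isOfFinAddOrder_inert_squarefree
    (hCLTZ : CoatesLiTianZhai2015.traceRelation_inert)
    (W : WeierstrassCurve ℚ) [W.IsElliptic] [W.IsGloballyMinimal] [NeZero (W.conductorNorm ℤ)]
    (hK : IsImaginaryQuadratic K)
    (ℓ₀ : ℕ) (hℓ₀ : ℓ₀.Prime) (hℓ₀' : 3 < ℓ₀) (hℓ₀'' : ℓ₀ % 4 = 3)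
    (hKℓ₀ : NumberField.discr K = -(ℓ₀ : ℤ))
    (hH : SatisfiesHeegnerHypothesis (W.conductorNorm ℤ) K)
    (Dt : ModularParametrizationData W (W.conductorNorm ℤ)) (β : ℤ)
    (hβ : (4 * (W.conductorNorm ℤ : ℤ)) ∣ β ^ 2 - NumberField.discr K)
    (y₁ : (W.baseChange (ringClassField K ι 1 : Type)).toAffine.Point)
    (hy₁ : WeierstrassCurve.Affine.Point.map (ringClassField K ι 1).subtype.toRatAlgHom y₁ =
      heegnerPointComplexOfConductor Dt (NumberField.discr K) β 1)
    (n : ℕ) [NumberField (ringClassField K ι n)] (hn : n ≠ 0) (hsq : Squarefree n)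
    (hnC : Nat.Coprime n (W.conductorNorm ℤ))
    (hinert : ∀ p : ℕ, p.Prime → p ∣ n → (Ideal.span {(p : 𝓞 K)}).IsPrime)
    (hodd : ∀ p : ℕ, p.Prime → p ∣ n → Odd (W.frobeniusTrace p))
    (y : (W.baseChange (ringClassField K ι n : Type)).toAffine.Point)
    (hy : WeierstrassCurve.Affine.Point.map (ringClassField K ι n).subtype.toRatAlgHom y =
      heegnerPointComplexOfConductor Dt (NumberField.discr K) β n)
    (yK : (W.baseChange K).toAffine.Point)
    (hyK : ∑ c : ringClassGal ι n ⧸ (ringClassGalOver ι n 1).subgroupOf (ringClassGal ι n),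
        pointGalHom W (ringClassField K ι n) (c.out : ringClassGal ι n).1
          (WeierstrassCurve.Affine.Point.map (W' := W)
            (RingClassField.inclusion ι
              (ringClassField_mono hK ι (one_dvd n) hn)).toRingHom.toRatAlgHom y₁) =
      WeierstrassCurve.Affine.Point.map (W' := W)
        (algebraMap K (ringClassField K ι n)).toRatAlgHom yK)
    (h2L : ∀ Q : (W.baseChange (ringClassField K ι n : Type)).toAffine.Point,
      (2 : ℕ) • Q = 0 → Q = 0)
    (hHy : ¬ ∃ R : (W.baseChange K).toAffine.Point, (2 : ℕ) • R = yK)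
    (s : ringClassGal ι n → ℤˣ) :
    ¬ IsOfFinAddOrder (∑ σ : ringClassGal ι n, (s σ : ℤ) •
      pointGalHom W (ringClassField K ι n) σ.1 y) :=
  genusPoint_not_isOfFinAddOrder_of_trace W hK ι hn y yK
    (GenusCongruence.odd_prod _ _ fun p hp =>
      hodd p (Nat.prime_of_mem_primeFactors hp) (Nat.dvd_of_mem_primeFactors hp))
    (sum_ringClassGal_eq_prod_smul_of_inert ι hCLTZ W hK ℓ₀ hℓ₀ hℓ₀' hℓ₀'' hKℓ₀ hH Dt β hβ y₁ hy₁ n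
      hn hsq hnC hinert y hy yK hyK) h2L hHy s

end Summit.BirchSwinnertonDyer.Uniform.U2.RingClass

end
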